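import Summits.CriticalPhenomena.PercolationContinuityZ3.Theorems.Transplant.FKConnectivityAllQAntipodalBridge
import Summits.CriticalPhenomena.PercolationContinuityZ3.Theorems.Transplant.FKConnectivityAllQHubCov
import HarnessLib

/-!
# Connectivity correlation inequalities for `φ_{w,q}`, every `q > 0` — the antipodal bridge for the HUB COVARIANCE BOUND:
# non-negative hub cells ⇒ `HubCovBoundUnder (φ_{w,q}) q v x x'` for every `w ∈ [0,1]^{Sym2 V}`

Helper file (`--supports stmt-CriticalPhenomena-4575`), FK sub-lane `prim-bschramm-fk-3` (gen 9); builds on p205010 (kernel theorem, internal audit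
signed; external expert review pending).  No named facts, no sorries, no new definitions.

`…AntipodalBridge.lean` re-indexed ordered pairs of configurations by cells `(σ, S, T)` and factorised the pair weight.  Here:
* `FK.sum_pair_weights_eq_sum_cells` — the expansion for an ARBITRARY pair functional `F`:
  `∑_{γ,γ'} W γ W γ' F γ γ' = ∑_σ ∑_{S ⊆ σᶜ} (∏_σ w²)(∏_S w(1-w))(∏_{(σ∪S)ᶜ}(1-w)²) · ∑_{T ⊆ S} q^{apExpC S σ T} F (σ∪T) (σ∪(S\T))`;
* **`FK.hubCovBoundUnder_of_hubCells_nonneg`** — for `0 < q`: if every HUB CELL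
  `∑_{T ⊆ S} q^{apExpC S σ T} [c_{xx'}(B)(1 - c_{vx}(B)) - (1-q)(c_{vx}(B) c_{vx'}(B) - c_{vx}(R) c_{vx'}(B))]` (`R = σ ∪ T`, `B = σ ∪ (S \ T)`,
  `c = FK.apConn`) is `≥ 0`, then the hub covariance bound `(1-q)·Cov_φ(1{v↔x},1{v↔x'}) ≤ φ(x↔x'↮v)·φ(Ω)` (`FK.HubCovBoundUnder`, fk-3 gen 7) holds for
  `φ = φ_{w,q}` — for EVERY edge-parameter vector `w`.  This is the kernel form of the reduction used by fk-3 gen 9's exact cell certificates (all hub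
  cells of `K₅, K₆, K₇` are polynomials in `q` with non-negative Bernstein coefficients on `[0,1]`): what remains for a kernel proof of the bound on
  `≤ n` vertices is the finite cell check itself.
[cite: Grimmett2006, §1.4 eq. (1.20) (p. 15); §3.9 eq. (3.94) (p. 63)]
-/

noncomputable section

namespace Summit.CriticalPhenomena.PercolationContinuityZ3.Theorems

namespace FK

open MeasureTheory Literature.Probability.LatticeModels Literature.Probability.Percolation
open Literature.Probability.Percolation.DecisionTree (ind ind_of_mem ind_of_not_mem ind_nonneg)
open scoped Classical

variable {V : Type*} [Fintype V]

/-- **Pair expansion for an arbitrary functional.**  `∑_{γ,γ' ⊆ E} W γ W γ' F γ γ'` expands over the cells `(σ, S)` with the bracket weights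
and the antipodal exponent `apExpC S σ T` (Grimmett 2006, (1.20) for the weights). [cite: Grimmett2006, §1.4 eq. (1.20) (p. 15)] -/
theorem sum_pair_weights_eq_sum_cells (w : Sym2 V → unitInterval) (q : ℝ) (F : Finset (Sym2 V) → Finset (Sym2 V) → ℝ) :
    ∑ γ ∈ (Finset.univ : Finset (Sym2 V)).powerset, ∑ γ' ∈ (Finset.univ : Finset (Sym2 V)).powerset,
        rcWeightW w q ∅ (↑γ : BondConfig V) * rcWeightW w q ∅ (↑γ' : BondConfig V) * F γ γ' =
      ∑ σ ∈ (Finset.univ : Finset (Sym2 V)).powerset, ∑ S ∈ (Finset.univ \ σ).powerset,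
        ((∏ e ∈ σ, (w e : ℝ) ^ 2) * (∏ e ∈ S, (w e : ℝ) * (1 - w e)) *
            ∏ e ∈ (Finset.univ \ σ) \ S, (1 - (w e : ℝ)) ^ 2) *
          ∑ T ∈ S.powerset, q ^ apExpC S σ T * F (σ ∪ T) (σ ∪ (S \ T)) := by
  rw [sum_pairs_eq_sum_cells]
  refine Finset.sum_congr rfl fun σ _ => ?_
  refine Finset.sum_congr rfl fun S hS => ?_
  rw [Finset.mul_sum]
  refine Finset.sum_congr rfl fun T hT => ?_
  rw [rcWeightW_pair_eq_cell w q (Finset.mem_powerset.1 hS) (Finset.mem_powerset.1 hT)]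
  ring

/-- The indicator of a connection event at a `Finset` configuration is fk-2's `apConn`. [folklore] -/
theorem ind_openConn_coe (γ : Finset (Sym2 V)) (s t : V) :
    ind (openConn s t) (↑γ : BondConfig V) = apConn γ s t := by
  unfold apConn
  by_cases hr : (openGraph (↑γ : BondConfig V)).Reachable s t
  · rw [if_pos hr]; exact ind_of_mem (show (↑γ : BondConfig V) ∈ openConn s t from hr)
  · rw [if_neg hr]; exact ind_of_not_mem (show (↑γ : BondConfig V) ∉ openConn s t from hr)

/-- Indicator of an intersection of two connection events. [folklore] -/
theorem ind_openConn_inter_coe (γ : Finset (Sym2 V)) (a b c d : V) :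
    ind (openConn a b ∩ openConn c d) (↑γ : BondConfig V) = apConn γ a b * apConn γ c d := by
  rw [← ind_openConn_coe, ← ind_openConn_coe]
  by_cases h1 : (↑γ : BondConfig V) ∈ openConn a b
  · by_cases h2 : (↑γ : BondConfig V) ∈ openConn c d
    · rw [ind_of_mem (Set.mem_inter h1 h2), ind_of_mem h1, ind_of_mem h2, mul_one]
    · rw [ind_of_not_mem (fun h => h2 h.2), ind_of_not_mem h2, mul_zero]
  · rw [ind_of_not_mem (fun h => h1 h.1), ind_of_not_mem h1, zero_mul]

/-- Indicator of 'not joined to `b`, and `c` joined to `d`'. [folklore] -/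
theorem ind_openConn_compl_inter_coe (γ : Finset (Sym2 V)) (a b c d : V) :
    ind ((openConn a b : Set (BondConfig V))ᶜ ∩ openConn c d) (↑γ : BondConfig V) = (1 - apConn γ a b) * apConn γ c d := by
  rw [← ind_openConn_coe, ← ind_openConn_coe]
  by_cases h1 : (↑γ : BondConfig V) ∈ openConn a b
  · rw [ind_of_not_mem (fun h => h.1 h1), ind_of_mem h1, sub_self, zero_mul]
  · by_cases h2 : (↑γ : BondConfig V) ∈ openConn c d
    · rw [ind_of_mem (Set.mem_inter h1 h2), ind_of_not_mem h1, ind_of_mem h2]; ring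
    · rw [ind_of_not_mem (fun h => h2 h.2), ind_of_not_mem h2, mul_zero]

/-- **Hub cells `≥ 0` ⇒ the hub covariance bound.**  For `0 < q` and every edge-parameter vector `w`: if for every cell `(σ, S)`
(`S ⊆ σᶜ`) the hub cell polynomial
`∑_{T ⊆ S} q^{apExpC S σ T} [c_{xx'}(B)(1 - c_{vx}(B)) - (1-q)(c_{vx}(B)c_{vx'}(B) - c_{vx}(R)c_{vx'}(B))]`, `R = σ ∪ T`, `B = σ ∪ (S \ T)`,
is non-negative, then `HubCovBoundUnder (φ_{w,q}) q v x x'`, i.e. `(1-q)·(φ(v↔x, v↔x')φ(Ω) - φ(v↔x)φ(v↔x')) ≤ φ(v↮x, x↔x')φ(Ω)`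
(Grimmett 2006, (3.94) for the covariance language). [cite: Grimmett2006, §1.4 eq. (1.20) (p. 15); §3.9 eq. (3.94) (p. 63)] -/
theorem hubCovBoundUnder_of_hubCells_nonneg {q : ℝ} (hq : 0 < q) (w : Sym2 V → unitInterval) (v x x' : V)
    (h : ∀ σ S : Finset (Sym2 V), S ⊆ Finset.univ \ σ →
      0 ≤ ∑ T ∈ S.powerset, q ^ apExpC S σ T *
        (apConn (σ ∪ (S \ T)) x x' * (1 - apConn (σ ∪ (S \ T)) v x) -
          (1 - q) * (apConn (σ ∪ (S \ T)) v x * apConn (σ ∪ (S \ T)) v x' -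
            apConn (σ ∪ T) v x * apConn (σ ∪ (S \ T)) v x'))) :
    HubCovBoundUnder (rcMeasureW w q ∅) q v x x' := by
  haveI := isProbabilityMeasure_rcMeasureW w hq (∅ : Set V)
  set Z := rcPartitionFunctionW w q ∅ with hZ
  have hZpos : 0 < Z := rcPartitionFunctionW_pos w hq (∅ : Set V)
  set Mab := ∑ ω : BondConfig V, rcWeightW w q ∅ ω * ind (openConn v x ∩ openConn v x') ω with hMab
  set Ma := ∑ ω : BondConfig V, rcWeightW w q ∅ ω * ind (openConn v x) ω with hMa
  set Mb := ∑ ω : BondConfig V, rcWeightW w q ∅ ω * ind (openConn v x') ω with hMb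
  set Mo := ∑ ω : BondConfig V, rcWeightW w q ∅ ω * ind ((openConn v x : Set (BondConfig V))ᶜ ∩ openConn x x') ω with hMo
  -- Step 1: the mass inequality `0 ≤ Z·Mo - (1-q)(Z·Mab - Ma·Mb)` from the cells
  have key : 0 ≤ Z * Mo - (1 - q) * (Z * Mab - Ma * Mb) := by
    -- all five masses as sums over the `Finset` power set
    have eZ : Z = ∑ γ ∈ (Finset.univ : Finset (Sym2 V)).powerset, rcWeightW w q ∅ (↑γ : BondConfig V) := by
      rw [hZ]; unfold rcPartitionFunctionW; exact sum_bondConfig_eq_sum_powerset _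
    have eMo : Mo = ∑ γ ∈ (Finset.univ : Finset (Sym2 V)).powerset,
        rcWeightW w q ∅ (↑γ : BondConfig V) * ((1 - apConn γ v x) * apConn γ x x') := by
      rw [hMo, sum_bondConfig_eq_sum_powerset]
      exact Finset.sum_congr rfl fun γ _ => by rw [ind_openConn_compl_inter_coe]
    have eMab : Mab = ∑ γ ∈ (Finset.univ : Finset (Sym2 V)).powerset,
        rcWeightW w q ∅ (↑γ : BondConfig V) * (apConn γ v x * apConn γ v x') := by
      rw [hMab, sum_bondConfig_eq_sum_powerset]
      exact Finset.sum_congr rfl fun γ _ => by rw [ind_openConn_inter_coe]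
    have eMa : Ma = ∑ γ ∈ (Finset.univ : Finset (Sym2 V)).powerset, rcWeightW w q ∅ (↑γ : BondConfig V) * apConn γ v x := by
      rw [hMa, sum_bondConfig_eq_sum_powerset]
      exact Finset.sum_congr rfl fun γ _ => by rw [ind_openConn_coe]
    have eMb : Mb = ∑ γ ∈ (Finset.univ : Finset (Sym2 V)).powerset, rcWeightW w q ∅ (↑γ : BondConfig V) * apConn γ v x' := by
      rw [hMb, sum_bondConfig_eq_sum_powerset]
      exact Finset.sum_congr rfl fun γ _ => by rw [ind_openConn_coe]
    -- the defect as ONE double sum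
    have hD : Z * Mo - (1 - q) * (Z * Mab - Ma * Mb) =
        ∑ γ ∈ (Finset.univ : Finset (Sym2 V)).powerset, ∑ γ' ∈ (Finset.univ : Finset (Sym2 V)).powerset,
          rcWeightW w q ∅ (↑γ : BondConfig V) * rcWeightW w q ∅ (↑γ' : BondConfig V) *
            (apConn γ' x x' * (1 - apConn γ' v x) -
              (1 - q) * (apConn γ' v x * apConn γ' v x' - apConn γ v x * apConn γ' v x')) := by
      rw [eZ, eMo, eMab, eMa, eMb, Finset.sum_mul_sum, Finset.sum_mul_sum, Finset.sum_mul_sum, ← Finset.sum_sub_distrib,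
        Finset.mul_sum, ← Finset.sum_sub_distrib]
      refine Finset.sum_congr rfl fun γ _ => ?_
      rw [← Finset.sum_sub_distrib, Finset.mul_sum, ← Finset.sum_sub_distrib]
      refine Finset.sum_congr rfl fun γ' _ => ?_
      ring
    rw [hD, sum_pair_weights_eq_sum_cells]
    refine Finset.sum_nonneg fun σ _ => Finset.sum_nonneg fun S hS => ?_
    refine mul_nonneg ?_ (h σ S (Finset.mem_powerset.1 hS))
    exact mul_nonneg (mul_nonneg (Finset.prod_nonneg fun e _ => sq_nonneg _)
      (Finset.prod_nonneg fun e _ => mul_nonneg (w e).2.1 (sub_nonneg.2 (w e).2.2))) (Finset.prod_nonneg fun e _ => sq_nonneg _)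
  -- Step 2: measure form
  have hab : (rcMeasureW w q ∅).real (openConn v x ∩ openConn v x') = Mab / Z := by
    rw [rcMeasureW_real_eq_sum_div w hq ∅]
  have ha : (rcMeasureW w q ∅).real (openConn v x) = Ma / Z := by
    rw [rcMeasureW_real_eq_sum_div w hq ∅]
  have hb : (rcMeasureW w q ∅).real (openConn v x') = Mb / Z := by
    rw [rcMeasureW_real_eq_sum_div w hq ∅]
  have ho : (rcMeasureW w q ∅).real ((openConn v x : Set (BondConfig V))ᶜ ∩ openConn x x') = Mo / Z := by
    rw [rcMeasureW_real_eq_sum_div w hq ∅]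
  unfold HubCovBoundUnder
  rw [probReal_univ, mul_one, mul_one, hab, ha, hb, ho]
  rw [show (1 - q) * (Mab / Z - Ma / Z * (Mb / Z)) = ((1 - q) * (Z * Mab - Ma * Mb)) / (Z * Z) by field_simp]
  rw [show Mo / Z = (Z * Mo) / (Z * Z) by field_simp, div_le_div_iff_of_pos_right (mul_pos hZpos hZpos)]
  linarith

/-- **Cells `≤ 0` ⇒ negative correlation of two events under `φ_{w,q}`.**  For `0 < q`, events `A, B` and every edge-parameter vector `w`:
if every cell `apPsiC q S σ 1̂_A 1̂_B` (`S ⊆ σᶜ`) is `≤ 0`, then `φ_{w,q}(A ∩ B) ≤ φ_{w,q}(A)·φ_{w,q}(B)` (Grimmett 2006, (1.20) for `φ`).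
[cite: Grimmett2006, §1.4 eq. (1.20) (p. 15); §3.8 (pp. 61–62)] -/
theorem rcMeasureW_real_inter_le_of_apPsiC_nonpos {q : ℝ} (hq : 0 < q) (w : Sym2 V → unitInterval) (A B : Set (BondConfig V))
    (h : ∀ σ S : Finset (Sym2 V), S ⊆ Finset.univ \ σ →
      apPsiC q S σ (fun γ => ind A (↑γ : BondConfig V)) (fun γ => ind B (↑γ : BondConfig V)) ≤ 0) :
    (rcMeasureW w q ∅).real (A ∩ B) ≤ (rcMeasureW w q ∅).real A * (rcMeasureW w q ∅).real B := by
  set Z := rcPartitionFunctionW w q ∅ with hZ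
  have hZpos : 0 < Z := rcPartitionFunctionW_pos w hq (∅ : Set V)
  set MA := ∑ ω : BondConfig V, rcWeightW w q ∅ ω * ind A ω with hMA
  set MB := ∑ ω : BondConfig V, rcWeightW w q ∅ ω * ind B ω with hMB
  set MAB := ∑ ω : BondConfig V, rcWeightW w q ∅ ω * ind (A ∩ B) ω with hMAB
  have key : Z * MAB ≤ MA * MB := by
    have e : MAB = ∑ ω : BondConfig V, rcWeightW w q ∅ ω * (ind A ω * ind B ω) := by
      rw [hMAB]
      refine Finset.sum_congr rfl fun ω _ => ?_
      by_cases hA : ω ∈ A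
      · by_cases hB : ω ∈ B
        · rw [ind_of_mem (Set.mem_inter hA hB), ind_of_mem hA, ind_of_mem hB]; ring
        · rw [ind_of_not_mem (fun h' => hB h'.2), ind_of_not_mem hB]; ring
      · rw [ind_of_not_mem (fun h' => hA h'.1), ind_of_not_mem hA]; ring
    rw [e, hZ]
    unfold rcPartitionFunctionW
    exact cov_nonpos_of_apPsiC_nonpos w q (ind A) (ind B) h
  have hab : (rcMeasureW w q ∅).real (A ∩ B) = MAB / Z := by rw [rcMeasureW_real_eq_sum_div w hq ∅]
  have ha : (rcMeasureW w q ∅).real A = MA / Z := by rw [rcMeasureW_real_eq_sum_div w hq ∅]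
  have hb : (rcMeasureW w q ∅).real B = MB / Z := by rw [rcMeasureW_real_eq_sum_div w hq ∅]
  rw [hab, ha, hb, show MA / Z * (MB / Z) = (MA * MB) / (Z * Z) by field_simp,
    show MAB / Z = (Z * MAB) / (Z * Z) by field_simp, div_le_div_iff_of_pos_right (mul_pos hZpos hZpos)]
  exact key

end FK

end Summit.CriticalPhenomena.PercolationContinuityZ3.Theorems
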